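import Mathlib
import Summits.Ventures.PercRepro2.Defs
import Summits.Ventures.PercRepro2.Independence
import Summits.Ventures.PercRepro2.Harris
import Summits.Ventures.PercRepro2.Graph
import Summits.Ventures.PercRepro2.Exploration
import Summits.Ventures.PercRepro2.Events
import Summits.Ventures.PercRepro2.Statements
import Summits.Ventures.PercRepro2.FourFunctions
import Summits.Ventures.PercRepro2.Induced
import Summits.Ventures.PercRepro2.Frontier
import Summits.Ventures.PercRepro2.ObsIndependence
import Summits.Ventures.PercRepro2.BHK
import Summits.Ventures.PercRepro2.BHKEvents
import Summits.Ventures.PercRepro2.ClusterProperty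
import Summits.Ventures.PercRepro2.KNTwo
import Summits.Ventures.PercRepro2.OrderPreservationFun

/-!
# The `|A| = 2` inequalities for general monotone cluster properties (blind cell PercRepro2, p1)

The indicator results of `KNTwo.lean` for arbitrary monotone cluster properties `f`
(Kozma–Nitzan §5.1, `IsMonotoneClusterProperty`):

* `r6Core_fun`: the `|A| = 2` core inequality `h₂ (X₁ − Y₁) + h₁ (X₂ − Y₂) ≥ 0` with
  `X_j = E[f(a_j); v ↔ a_j, D]`, `Y_j = E[f(a_{3−j}); v ↔ a_j, D]`;
* `r6FirstHitCoefficient_pair` and the closures `r6FirstHitCoefficient_card_two`,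
  `knTheorem7` (Kozma–Nitzan Theorem 7, proof omitted in print): Conjecture 4 at `|A| = 2`.

Nonnegativity of `f` is not assumed in the final statements: they are invariant under
`f ↦ f − m`, and `m = min f` makes `f − m ≥ 0`.
-/

namespace Summit.Ventures.PercRepro2

section R6Fun

variable {V : Type*} {E : Type*} [Fintype E] [DecidableEq E] [Fintype V] [DecidableEq V]
  {R : Type*} [Field R] [LinearOrder R] [IsStrictOrderedRing R]

/-- **R6-core for nonnegative monotone cluster properties**: with `D = {a₁ ↮ a₂}`,
`h_j = P(v ↔ a_j, D)`, `X_j = E[f(a_j); v ↔ a_j, D]`, `Y_j = E[f(a_{3−j}); v ↔ a_j, D]`,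
`h₂ (X₁ − Y₁) + h₁ (X₂ − Y₂) ≥ 0`. -/
theorem r6Core_fun (p : E → R) (hp : IsProbVec p) (ends : E → Sym2 V) (v a₁ a₂ : V)
    {f : V → Config E → R} (hf : IsMonotoneClusterProperty ends f) (hf0 : ∀ x ω, 0 ≤ f x ω) :
    0 ≤ prob p (connEvent ends v a₂ ∩ (connEvent ends a₁ a₂)ᶜ) *
        (expect p (fun ω => f a₁ ω * (connEvent ends v a₁ ∩ (connEvent ends a₁ a₂)ᶜ).indicator 1 ω) -
          expect p (fun ω => f a₂ ω * (connEvent ends v a₁ ∩ (connEvent ends a₁ a₂)ᶜ).indicator 1 ω)) +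
      prob p (connEvent ends v a₁ ∩ (connEvent ends a₁ a₂)ᶜ) *
        (expect p (fun ω => f a₂ ω * (connEvent ends v a₂ ∩ (connEvent ends a₁ a₂)ᶜ).indicator 1 ω) -
          expect p (fun ω => f a₁ ω * (connEvent ends v a₂ ∩ (connEvent ends a₁ a₂)ᶜ).indicator 1 ω)) := by
  classical
  -- the indicator cluster property of `{W | v ∈ W}`: `1{x ↔ v}`
  have hv : IsUpperSet {W : Set V | v ∈ W} := fun _ _ h hv => h hv
  have hind : IsMonotoneClusterProperty ends (clusterIndicator (R := R) ends {W | v ∈ W}) :=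
    isMonotoneClusterProperty_clusterIndicator ends hv
  have hind0 : ∀ x ω, 0 ≤ clusterIndicator (R := R) ends {W | v ∈ W} x ω := fun x ω =>
    Set.indicator_apply_nonneg fun _ => zero_le_one
  have eind : ∀ x ω, clusterIndicator (R := R) ends {W | v ∈ W} x ω =
      (connEvent ends v x).indicator 1 ω := by
    intro x ω
    show (clusterInEvent ends x {W | v ∈ W}).indicator 1 ω = _
    rw [clusterInEvent_mem_eq_connEvent]
  have eD : (connEvent ends a₂ a₁)ᶜ = (connEvent ends a₁ a₂)ᶜ := by rw [connEvent_comm]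
  -- products of indicators
  have eprod : ∀ (x : V) (A B : Set (Config E)), (fun ω => f x ω * A.indicator 1 ω * B.indicator 1 ω) =
      fun ω => f x ω * (A ∩ B).indicator 1 ω := by
    intro x A B
    funext ω
    rw [indicator_inter_one, mul_assoc]
  have eprod' : ∀ (A B : Set (Config E)), (fun ω => A.indicator (1 : Config E → R) ω * B.indicator 1 ω) =
      fun ω => (A ∩ B).indicator 1 ω := by
    intro A B
    funext ω
    rw [indicator_inter_one]
  -- (S) at `a_j`: `P_j · h_j ≤ X_j · d`
  have a1 := bhk_same_cluster_fun p hp ends a₁ a₂ hf hind (hf0 a₁) (hind0 a₁)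
  have a2 := bhk_same_cluster_fun p hp ends a₂ a₁ hf hind (hf0 a₂) (hind0 a₂)
  -- (L) at `(a_{3−j}, a_j)`: `Y_j · d ≤ P_{3−j} · h_j`
  have b1 := bhk_cross_cluster_fun p hp ends a₂ a₁ hf hind (hf0 a₂)
  have b2 := bhk_cross_cluster_fun p hp ends a₁ a₂ hf hind (hf0 a₁)
  simp only [eind, eD, eprod, eprod'] at a1 a2 b1 b2
  -- the `h_j` as expectations of indicators (matching the BHK factors)
  have eh : ∀ x, prob p (connEvent ends v x ∩ (connEvent ends a₁ a₂)ᶜ) =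
      expect p (fun ω => (connEvent ends v x ∩ (connEvent ends a₁ a₂)ᶜ).indicator 1 ω) :=
    fun x => prob_eq_expect_indicator p _
  rw [eh a₁, eh a₂]
  -- names and signs
  have hh₁ : 0 ≤ expect p (fun ω => (connEvent ends v a₁ ∩ (connEvent ends a₁ a₂)ᶜ).indicator 1 ω) := by
    rw [← eh]; exact prob_nonneg hp _
  have hh₂ : 0 ≤ expect p (fun ω => (connEvent ends v a₂ ∩ (connEvent ends a₁ a₂)ᶜ).indicator 1 ω) := by
    rw [← eh]; exact prob_nonneg hp _
  have hd : 0 ≤ prob p (connEvent ends a₁ a₂)ᶜ := prob_nonneg hp _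
  have h₁d : expect p (fun ω => (connEvent ends v a₁ ∩ (connEvent ends a₁ a₂)ᶜ).indicator 1 ω) ≤
      prob p (connEvent ends a₁ a₂)ᶜ := by
    rw [← eh]; exact prob_mono hp Set.inter_subset_right
  have h₂d : expect p (fun ω => (connEvent ends v a₂ ∩ (connEvent ends a₁ a₂)ᶜ).indicator 1 ω) ≤
      prob p (connEvent ends a₁ a₂)ᶜ := by
    rw [← eh]; exact prob_mono hp Set.inter_subset_right
  set d := prob p (connEvent ends a₁ a₂)ᶜ
  set h₁ := expect p (fun ω => (connEvent ends v a₁ ∩ (connEvent ends a₁ a₂)ᶜ).indicator 1 ω)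
  set h₂ := expect p (fun ω => (connEvent ends v a₂ ∩ (connEvent ends a₁ a₂)ᶜ).indicator 1 ω)
  set X₁ := expect p (fun ω => f a₁ ω * (connEvent ends v a₁ ∩ (connEvent ends a₁ a₂)ᶜ).indicator 1 ω)
  set X₂ := expect p (fun ω => f a₂ ω * (connEvent ends v a₂ ∩ (connEvent ends a₁ a₂)ᶜ).indicator 1 ω)
  set Y₁ := expect p (fun ω => f a₂ ω * (connEvent ends v a₁ ∩ (connEvent ends a₁ a₂)ᶜ).indicator 1 ω)
  set Y₂ := expect p (fun ω => f a₁ ω * (connEvent ends v a₂ ∩ (connEvent ends a₁ a₂)ᶜ).indicator 1 ω)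
  set P₁ := expect p (fun ω => f a₁ ω * ((connEvent ends a₁ a₂)ᶜ).indicator 1 ω)
  set P₂ := expect p (fun ω => f a₂ ω * ((connEvent ends a₁ a₂)ᶜ).indicator 1 ω)
  have e1 := mul_le_mul_of_nonneg_left a1 hh₂
  have e2 := mul_le_mul_of_nonneg_left b1 hh₂
  have e3 := mul_le_mul_of_nonneg_left a2 hh₁
  have e4 := mul_le_mul_of_nonneg_left b2 hh₁
  have key : 0 ≤ (h₂ * (X₁ - Y₁) + h₁ * (X₂ - Y₂)) * d := by linarith
  rcases hd.lt_or_eq with hd0 | hd0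
  · have h0 : 0 * d ≤ (h₂ * (X₁ - Y₁) + h₁ * (X₂ - Y₂)) * d := by rw [zero_mul]; exact key
    exact le_of_mul_le_mul_right h0 hd0
  · have h₁0 : h₁ = 0 := le_antisymm (hd0 ▸ h₁d) hh₁
    have h₂0 : h₂ = 0 := le_antisymm (hd0 ▸ h₂d) hh₂
    rw [h₁0, h₂0]
    ring_nf
    exact le_refl 0

end R6Fun

section R6Closures

variable {V : Type*} {E : Type*} [Fintype E] [DecidableEq E] [Fintype V] [DecidableEq V]
  {R : Type*} [Field R] [LinearOrder R] [IsStrictOrderedRing R]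

omit [Fintype V] [DecidableEq V] [LinearOrder R] [IsStrictOrderedRing R] in
/-- Three-way split of `E[g 1_{C₁ ∪ C₂}]`. -/
lemma expect_mul_indicator_union_three (p : E → R) (g : Config E → R) (C₁ C₂ : Set (Config E)) :
    expect p (fun ω => g ω * (C₁ ∪ C₂).indicator 1 ω) =
      expect p (fun ω => g ω * (C₁ ∩ C₂).indicator 1 ω) +
      expect p (fun ω => g ω * (C₁ ∩ C₂ᶜ).indicator 1 ω) +
      expect p (fun ω => g ω * (C₂ ∩ C₁ᶜ).indicator 1 ω) := by
  rw [← expect_add, ← expect_add]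
  congr 1
  funext ω
  simp only [Pi.add_apply]
  by_cases h1 : ω ∈ C₁ <;> by_cases h2 : ω ∈ C₂ <;> simp [h1, h2]

/-- `E[g 1_A] = 0` when `P(A) = 0` (for any observable `g`). -/
lemma expect_mul_indicator_eq_zero_of_prob_eq_zero {p : E → R} (hp : IsProbVec p)
    {A : Set (Config E)} (hA : prob p A = 0) (g : Config E → R) :
    expect p (fun ω => g ω * A.indicator 1 ω) = 0 := by
  have hw : ∀ ω ∈ A, weight p ω = 0 := by
    intro ω hω
    unfold prob at hA
    have := (Finset.sum_eq_zero_iff_of_nonneg fun ω _ =>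
      Set.indicator_apply_nonneg fun _ => weight_nonneg hp ω).1 hA ω (Finset.mem_univ ω)
    rwa [Set.indicator_of_mem hω] at this
  unfold expect
  refine Finset.sum_eq_zero fun ω _ => ?_
  by_cases hω : ω ∈ A
  · rw [hw ω hω, zero_mul]
  · simp [hω]

omit [Fintype V] [LinearOrder R] [IsStrictOrderedRing R] in
/-- The three-region form of `E(f(x) · 1{v ↔ {a₁, a₂}})`, with `D = {a₁ ↮ a₂}`. -/
lemma hitExpect_pair (p : E → R) (ends : E → Sym2 V) (v a₁ a₂ x : V) (f : V → Config E → R) :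
    hitExpect p ends {a₁, a₂} v f x =
      expect p (fun ω => f x ω * (connEvent ends v a₁ ∩ connEvent ends v a₂).indicator 1 ω) +
      expect p (fun ω => f x ω * (connEvent ends v a₁ ∩ (connEvent ends a₁ a₂)ᶜ).indicator 1 ω) +
      expect p (fun ω => f x ω * (connEvent ends v a₂ ∩ (connEvent ends a₁ a₂)ᶜ).indicator 1 ω) := by
  unfold hitExpect
  rw [hitEvent_pair, expect_mul_indicator_union_three, connEvent_inter_compl_connEvent_eq,
    connEvent_inter_compl_connEvent_eq ends v a₂ a₁, connEvent_comm ends a₂ a₁]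

omit [Fintype V] [DecidableEq V] [IsStrictOrderedRing R] in
/-- On `{v ↔ x}` a monotone cluster property takes the same value at `x` and `v`. -/
lemma expect_mul_indicator_conn_eq (p : E → R) {ends : E → Sym2 V} {f : V → Config E → R}
    (hf : IsMonotoneClusterProperty ends f) (v x : V) (A : Set (Config E)) :
    expect p (fun ω => f x ω * (connEvent ends v x ∩ A).indicator 1 ω) =
      expect p (fun ω => f v ω * (connEvent ends v x ∩ A).indicator 1 ω) :=
  expect_mul_indicator_congr p fun _ hω => (hf.eq_of_conn hω.1).symm

/-- **R6 at `A = {a₁, a₂}` for nonnegative monotone cluster properties**. -/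
theorem r6FirstHit_pair_of_nonneg (p : E → R) (hp : IsProbVec p) (ends : E → Sym2 V) (v : V)
    {a₁ a₂ : V} (hne : a₁ ≠ a₂) {f : V → Config E → R} (hf : IsMonotoneClusterProperty ends f)
    (hf0 : ∀ x ω, 0 ≤ f x ω) : R6FirstHitCoefficient p ends {a₁, a₂} v f := by
  intro hpos
  have core := r6Core_fun p hp ends v a₁ a₂ hf hf0
  simp only [Finset.sum_pair hne] at hpos ⊢
  rw [firstHitWeight_pair_left p ends hne v, firstHitWeight_pair_right p ends hne v] at hpos ⊢
  simp only [hitExpect_pair]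
  -- cluster identifications
  have c12 : expect p (fun ω => f a₂ ω * (connEvent ends v a₁ ∩ connEvent ends v a₂).indicator 1 ω) =
      expect p (fun ω => f v ω * (connEvent ends v a₁ ∩ connEvent ends v a₂).indicator 1 ω) :=
    expect_mul_indicator_congr p fun _ hω => (hf.eq_of_conn hω.2).symm
  have c11 : expect p (fun ω => f a₁ ω * (connEvent ends v a₁ ∩ connEvent ends v a₂).indicator 1 ω) =
      expect p (fun ω => f v ω * (connEvent ends v a₁ ∩ connEvent ends v a₂).indicator 1 ω) :=
    expect_mul_indicator_congr p fun _ hω => (hf.eq_of_conn hω.1).symm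
  have x1 := expect_mul_indicator_conn_eq p hf v a₁ (connEvent ends a₁ a₂)ᶜ
  have x2 := expect_mul_indicator_conn_eq p hf v a₂ (connEvent ends a₁ a₂)ᶜ
  rw [c11, c12, x1, x2]
  rw [x1, x2] at core
  set c := expect p (fun ω => f v ω * (connEvent ends v a₁ ∩ connEvent ends v a₂).indicator 1 ω)
  set X₁ := expect p (fun ω => f v ω * (connEvent ends v a₁ ∩ (connEvent ends a₁ a₂)ᶜ).indicator 1 ω)
  set X₂ := expect p (fun ω => f v ω * (connEvent ends v a₂ ∩ (connEvent ends a₁ a₂)ᶜ).indicator 1 ω)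
  set Y₁ := expect p (fun ω => f a₂ ω * (connEvent ends v a₁ ∩ (connEvent ends a₁ a₂)ᶜ).indicator 1 ω)
  set Y₂ := expect p (fun ω => f a₁ ω * (connEvent ends v a₂ ∩ (connEvent ends a₁ a₂)ᶜ).indicator 1 ω)
  set h₁ := prob p (connEvent ends v a₁ ∩ (connEvent ends a₁ a₂)ᶜ)
  set h₂ := prob p (connEvent ends v a₂ ∩ (connEvent ends a₁ a₂)ᶜ)
  rw [div_mul_eq_mul_div, div_mul_eq_mul_div, ← add_div, div_le_iff₀ hpos]
  nlinarith [core]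

omit [Fintype E] [DecidableEq E] [Fintype V] [DecidableEq V] in
/-- Shifting a monotone cluster property by a constant. -/
lemma isMonotoneClusterProperty_sub_const {ends : E → Sym2 V} {f : V → Config E → R}
    (hf : IsMonotoneClusterProperty ends f) (m : R) :
    IsMonotoneClusterProperty ends (fun x ω => f x ω - m) where
  mono := fun x ω ξ h => sub_le_sub_right (hf.mono x ω ξ h) m
  eq_of_openAdj := fun x y ω h => by simp only [hf.eq_of_openAdj x y ω h]

omit [Fintype V] [DecidableEq V] [LinearOrder R] [IsStrictOrderedRing R] in
/-- `hitExpect` of a shifted property. -/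
lemma hitExpect_sub_const (p : E → R) (ends : E → Sym2 V) (A : Finset V) (v : V)
    (f : V → Config E → R) (m : R) (x : V) :
    hitExpect p ends A v (fun x ω => f x ω - m) x =
      hitExpect p ends A v f x - m * prob p (hitEvent ends v A) := by
  unfold hitExpect
  rw [prob_eq_expect_indicator, ← expect_const_mul, ← expect_sub]
  congr 1
  funext ω
  simp only [Pi.sub_apply]
  ring

/-- **R6 at `A = {a₁, a₂}` for every monotone cluster property** (`r6FirstHit_pair`): shift by the
minimum value to reduce to the nonnegative case. -/
theorem r6FirstHit_pair (p : E → R) (hp : IsProbVec p) (ends : E → Sym2 V) (v : V) {a₁ a₂ : V}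
    (hne : a₁ ≠ a₂) {f : V → Config E → R} (hf : IsMonotoneClusterProperty ends f) :
    R6FirstHitCoefficient p ends {a₁, a₂} v f := by
  classical
  haveI : Nonempty (V × Config E) := ⟨(v, fun _ => false)⟩
  set m : R := Finset.univ.inf' Finset.univ_nonempty (fun xω : V × Config E => f xω.1 xω.2) with hm
  have hm_le : ∀ x ω, m ≤ f x ω := fun x ω =>
    Finset.inf'_le (fun xω : V × Config E => f xω.1 xω.2) (Finset.mem_univ (x, ω))
  have hshift := r6FirstHit_pair_of_nonneg p hp ends v hne (isMonotoneClusterProperty_sub_const hf m)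
    (fun x ω => sub_nonneg.2 (hm_le x ω))
  intro hpos
  have h := hshift hpos
  simp only [hitExpect_sub_const] at h
  -- the coefficients sum to one
  have hsum : ∑ a ∈ ({a₁, a₂} : Finset V),
      firstHitWeight p ends v {a₁, a₂} a / ∑ a' ∈ ({a₁, a₂} : Finset V), firstHitWeight p ends v {a₁, a₂} a' = 1 := by
    rw [← Finset.sum_div, div_self hpos.ne']
  have e : ∑ a ∈ ({a₁, a₂} : Finset V),
      firstHitWeight p ends v {a₁, a₂} a / (∑ a' ∈ ({a₁, a₂} : Finset V), firstHitWeight p ends v {a₁, a₂} a') *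
        (hitExpect p ends {a₁, a₂} v f a - m * prob p (hitEvent ends v {a₁, a₂})) =
      (∑ a ∈ ({a₁, a₂} : Finset V),
        firstHitWeight p ends v {a₁, a₂} a / (∑ a' ∈ ({a₁, a₂} : Finset V), firstHitWeight p ends v {a₁, a₂} a') *
          hitExpect p ends {a₁, a₂} v f a) - m * prob p (hitEvent ends v {a₁, a₂}) := by
    simp only [mul_sub, Finset.sum_sub_distrib, ← Finset.sum_mul, hsum, one_mul]
  rw [e] at h
  linarith

end R6Closures

section FinalClosures

variable (R : Type) [Field R] [LinearOrder R] [IsStrictOrderedRing R]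

/-- **R6 for every finite graph, every monotone cluster property, `|A| = 2`**:
`R6FirstHitCoefficient_card_two R`. -/
theorem r6FirstHitCoefficient_card_two : R6FirstHitCoefficient_card_two R := by
  intro V E _ _ _ _ ends p hp A v f hA hf
  obtain ⟨a₁, a₂, hne, rfl⟩ := Finset.card_eq_two.1 hA
  exact r6FirstHit_pair p hp ends v hne hf

/-- **Kozma–Nitzan Theorem 7** for every finite graph and every monotone cluster property:
`KNTheorem7 R` (Conjecture 4 at `|A| = 2`; the proof is omitted in KN24). -/
theorem knTheorem7 : KNTheorem7 R := by
  intro V E _ _ _ _ ends p hp v a₁ a₂ f hf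
  by_cases hne : a₁ = a₂
  · -- `A = {a₁}`: `min = E(f(a₁); v ↔ a₁) = E(f(v); v ↔ a₁)`
    subst hne
    unfold KNConjecture4
    have e : ({a₁, a₁} : Finset V) = {a₁} := by simp
    simp only [e, Finset.inf'_singleton]
    unfold hitExpect
    have eh : hitEvent ends v {a₁} = connEvent ends v a₁ := by
      ext ω; simp [hitEvent]
    simp only [eh]
    exact le_of_eq (expect_mul_indicator_congr p fun _ hω => (hf.eq_of_conn hω).symm)
  by_cases hpos : 0 < ∑ a ∈ ({a₁, a₂} : Finset V), firstHitWeight p ends v {a₁, a₂} a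
  · exact KNConjecture4_of_R6FirstHitCoefficient hp _ hpos (r6FirstHit_pair p hp ends v hne hf)
  -- degenerate case: both first-hit weights vanish, the three expectations coincide
  rw [Finset.sum_pair hne, firstHitWeight_pair_left p ends hne v,
    firstHitWeight_pair_right p ends hne v] at hpos
  have hh₁ : 0 ≤ prob p (connEvent ends v a₁ ∩ (connEvent ends a₁ a₂)ᶜ) := prob_nonneg hp _
  have hh₂ : 0 ≤ prob p (connEvent ends v a₂ ∩ (connEvent ends a₁ a₂)ᶜ) := prob_nonneg hp _
  have h₁0 : prob p (connEvent ends v a₁ ∩ (connEvent ends a₁ a₂)ᶜ) = 0 := by linarith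
  have h₂0 : prob p (connEvent ends v a₂ ∩ (connEvent ends a₁ a₂)ᶜ) = 0 := by linarith
  have eq : ∀ x : V, hitExpect p ends {a₁, a₂} v f x =
      expect p (fun ω => f x ω * (connEvent ends v a₁ ∩ connEvent ends v a₂).indicator 1 ω) := by
    intro x
    rw [hitExpect_pair, expect_mul_indicator_eq_zero_of_prob_eq_zero hp h₁0,
      expect_mul_indicator_eq_zero_of_prob_eq_zero hp h₂0, add_zero, add_zero]
  have ev : hitExpect p ends {a₁, a₂} v f a₁ = hitExpect p ends {a₁, a₂} v f v := by
    rw [eq, eq]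
    exact expect_mul_indicator_congr p fun _ hω => (hf.eq_of_conn hω.1).symm
  unfold KNConjecture4
  rw [← ev]
  exact Finset.inf'_le _ (Finset.mem_insert_self a₁ {a₂})

end FinalClosures

end Summit.Ventures.PercRepro2
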